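import Literature.NumberTheory.LFunctions.ClassGroupLogFreeZeroSideAllDegrees
import Literature.NumberTheory.LFunctions.ClassGroupLogFreeSavingAllDegrees
import HarnessLib

/-!
# Bombieri's Théorème 14 for the class group characters, II: the middle range — every degree

Topic `Literature/NumberTheory/LFunctions`, namespace `Literature.NumberTheory.LFunctions.NumberField`.
Everything here is PROVED (theorems only; no definitions, no named facts).

The tree's `middleRange_CG` (`ClassGroupLogFreeMiddleRange.lean`, Bombieri, *Le grand crible*, §6,
Théorème 14, pp. 48–50, with the log-free mean value theorem of Thorner–Zaman in place of Théorème 11)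
is stated for number fields of degree `n_K ≤ 4`: the zero side used Lemme B with slack `≤ 4`, the sieve
side used the kernel `A = 2T'` (Gallagher's condition `(m+1)T'² ≤ 3A²`, `m = n_K + 3`) and the
numerical bounds `balancePoint_le`, `secondary_le`, `lemmaAHeight_le` with absolute constants.  With the
all-degree zero side (`zeroSide_CG_of_le`), the wide kernel `A = (n+2)T'` and the degree-dependent saving
(`card_mul_meanValueConst_wide_le_param`, sieve parameter `z = ⌊N_X^{1/(2n+4)}⌋`) the same proof gives

* `middleRange_CG_of_le (n)` — for every `c₀ > 0` there are `δ₀, A, C > 0` depending only on `n, c₀` such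
  that for every `K` with `n_K ≤ n` whose `L₀(s, χ)`, `χ ≠ 1`, do not vanish on `Re s ≥ 1`, every `P ≥ 2`
  with `|d_K| ≤ P`, `h_K ≤ P`, `κ_K ≥ 1/P`, all finite sets `Z(χ)` of zeros of `L₀(s, χ)` in `0 < β < 1`,
  `|γ| ≤ P`, and `c₀/log P ≤ 1 − α ≤ δ₀`: `Σ_{χ ≠ 1} Σ_{ρ ∈ Z(χ), β ≥ α} m(ρ) ≤ C P^{A(1−α)}`.

The assembly with the small and the trivial range is in `ClassGroupLogFreeTheorem14AllDegrees.lean`.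

## References

* [Bombieri1987GrandCrible] E. Bombieri, Astérisque 18 (1987), §6 Théorème 14, pp. 48–50.
* [ThornerZaman2017] J. Thorner, A. Zaman, Algebra Number Theory 11 (2017), Theorem 4.2, §5.
* [ThornerZaman2019] J. Thorner, A. Zaman, Algebra Number Theory 13 (2019) 1039–1068, Thm. 3.2.
* [Weiss1983] A. Weiss, J. reine angew. Math. 338 (1983) 56–94, Thm. 4.3.
-/

noncomputable section

open Complex Finset Filter Real MeasureTheory
open scoped LSeries.notation ArithmeticFunction.vonMangoldt Topology Nat

namespace Literature.NumberTheory.LFunctions.NumberField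

open Literature.NumberTheory.LFunctions.LogFreeLocal Literature.NumberTheory.LFunctions.LogFreeDensity
  Literature.NumberTheory.LFunctions.AbelianDensity
open scoped nonZeroDivisors _root_.NumberField

set_option maxHeartbeats 1600000 in
open scoped Classical in
/-- **Théorème 14 for `Ĉl_K` in the middle range, every degree** (Bombieri pp. 48–50 with the log-free
mean value theorem of Thorner–Zaman in place of Théorème 11, wide kernel `A = (n+2)T'`, sieve parameter
`z = ⌊N_X^{1/(2n+4)}⌋`): for every `n` and `c₀ > 0` there are `δ₀, A, C > 0` (depending on `n, c₀` only)
such that for every number field `K` with `n_K ≤ n` whose `L₀(s, χ)`, `χ ≠ 1`, do not vanish on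
`Re s ≥ 1`, every `P ≥ 2` with `|d_K| ≤ P`, `h_K ≤ P`, `κ_K ≥ 1/P`, all finite sets `Z(χ)` of zeros of
`L₀(s, χ)` in `0 < β < 1`, `|γ| ≤ P`, and `c₀/log P ≤ 1 − α ≤ δ₀`:
`Σ_{ψ ≠ 0} Σ_{ρ ∈ Z(χ_ψ), β ≥ α} m(ρ) ≤ C P^{A(1−α)}`. [cite: Bombieri1987GrandCrible, §6 Théorème 14] -/
theorem middleRange_CG_of_le (n : ℕ) {c₀ : ℝ} (hc₀ : 0 < c₀) :
    ∃ δ₀ A C : ℝ, 0 < δ₀ ∧ 0 < A ∧ 0 < C ∧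
      ∀ (K : Type*) [Field K] [NumberField K], Module.finrank ℚ K ≤ n →
        (∀ χ : ClassGroup (𝓞 K) →* ℂˣ, χ ≠ 1 → ∀ ρ : ℂ, classGroupLFunction₀ K χ ρ = 0 → ρ.re < 1) →
        ∀ P : ℝ, 2 ≤ P → ((NumberField.discr K).natAbs : ℝ) ≤ P →
          (Fintype.card (ClassGroup (𝓞 K)) : ℝ) ≤ P → P⁻¹ ≤ NumberField.dedekindZeta_residue K →
        ∀ Z : (ClassGroup (𝓞 K) →* ℂˣ) → Finset ℂ,
          (∀ χ : ClassGroup (𝓞 K) →* ℂˣ, χ ≠ 1 → ∀ ρ ∈ Z χ,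
              classGroupLFunction₀ K χ ρ = 0 ∧ 0 < ρ.re ∧ ρ.re < 1 ∧ |ρ.im| ≤ P) →
          ∀ α : ℝ, c₀ / Real.log P ≤ 1 - α → 1 - α ≤ δ₀ →
            ∑ ψ : AddChar (Additive (ClassGroup (𝓞 K))) ℂ with ψ ≠ 0,
              ∑ ρ ∈ Z (toMulHom ψ).toHomUnits with α ≤ ρ.re,
                (zeroOrder (classGroupLFunction₀ K (toMulHom ψ).toHomUnits) ρ : ℝ) ≤ C * P ^ (A * (1 - α)) := by
  obtain ⟨A₀, r₀, C_z, hA₀, hr₀, hC_z, hZS⟩ := zeroSide_CG_of_le n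
  obtain ⟨D, C_M, hDpos, hC_Mpos, hSV⟩ := card_mul_meanValueConst_wide_le_param n
  have hn0 : (0 : ℝ) ≤ n := Nat.cast_nonneg n
  set a : ℝ := expoB with ha
  have hapos : 0 < a := expoB_pos
  have ha1 : a ≤ 1 / 2 := expoB_le_half
  set B : ℝ := max (3888000 * ((n : ℝ) + 1) ^ 2) (max 8 (1 / (2 * c₀))) with hB
  have hB0 : 3888000 * ((n : ℝ) + 1) ^ 2 ≤ B := le_max_left _ _
  have hB8 : 8 ≤ B := (le_max_left _ _).trans (le_max_right _ _)
  have hBc : 1 / (2 * c₀) ≤ B := (le_max_right _ _).trans (le_max_right _ _)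
  have hBpos : 0 < B := by linarith
  set A₁ : ℝ := max A₀ ((D + 2200) / (a * B)) with hA₁
  have hA₁pos : 0 < A₁ := lt_of_lt_of_le hA₀ (le_max_left _ _)
  have hA₁A₀ : A₀ ≤ A₁ := le_max_left _ _
  have hA₁a : (D + 2200) / (a * B) ≤ A₁ := le_max_right _ _
  set K₁ : ℝ := 256 * π * C_z * C_M * A₁ ^ 2 * B ^ 3 with hK₁
  refine ⟨min (r₀ / 2) (1 / 2), (A₁ * B / 10 + 3) * 2, ((n : ℝ) + 1) ^ 2 * (K₁ * Real.exp 10),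
    by positivity, by positivity, by positivity, fun K _ _ hnK hline P hP hd hh hκ Z hZ α hα1 hα2 => ?_⟩
  /- ── parameters ── -/
  have hPpos : 0 < P := by linarith
  set Lp : ℝ := Real.log P with hLp
  have hLp2 : Real.log 2 ≤ Lp := Real.log_le_log (by norm_num) hP
  have hlog2 : (0.69 : ℝ) ≤ Real.log 2 := by have := Real.log_two_gt_d9; linarith
  have hLppos : 0 < Lp := by linarith
  set r : ℝ := 2 * (1 - α) with hr
  have hδ : 1 - α ≤ r₀ / 2 := hα2.trans (min_le_left _ _)
  have hδ' : 1 - α ≤ 1 / 2 := hα2.trans (min_le_right _ _)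
  have h1α : c₀ / Lp ≤ 1 - α := hα1
  have h1αpos : 0 < 1 - α := lt_of_lt_of_le (by positivity) h1α
  have hrpos : 0 < r := by rw [hr]; linarith
  have hrr₀ : r ≤ r₀ := by rw [hr]; linarith
  have hr1 : r ≤ 1 := by rw [hr]; linarith
  set L' : ℝ := B * Lp with hL'
  have hL'8 : 8 * Lp ≤ L' := by rw [hL']; exact mul_le_mul_of_nonneg_right hB8 hLppos.le
  have hL'1 : 1 ≤ L' := by linarith
  have hu : 1 ≤ r * L' := by
    rw [hr, hL']
    have h1 : c₀ ≤ (1 - α) * Lp := by rwa [div_le_iff₀ hLppos] at h1α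
    have h2 : 1 ≤ 2 * c₀ * B := by
      rw [div_le_iff₀ (by positivity)] at hBc; linarith
    calc (1 : ℝ) ≤ 2 * c₀ * B := h2
      _ ≤ 2 * ((1 - α) * Lp) * B := by nlinarith only [h1, hBpos, hc₀]
      _ = 2 * (1 - α) * (B * Lp) := by ring
  set Lx : ℝ := A₁ * L' with hLx
  set x : ℝ := Real.exp Lx with hx
  have hxpos : 0 < x := Real.exp_pos _
  have hlogx : Real.log x = Lx := Real.log_exp _
  have hLxA₀ : A₀ * L' ≤ Real.log x := by
    rw [hlogx, hLx]; exact mul_le_mul_of_nonneg_right hA₁A₀ (by positivity)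
  have haLxD : (D + 2200) * Lp ≤ a * Lx := by
    rw [hLx, hL']
    have h1 : (D + 2200) / (a * B) * (B * Lp) ≤ A₁ * (B * Lp) :=
      mul_le_mul_of_nonneg_right hA₁a (by positivity)
    have h2 : a * ((D + 2200) / (a * B) * (B * Lp)) = (D + 2200) * Lp := by field_simp
    calc (D + 2200) * Lp = a * ((D + 2200) / (a * B) * (B * Lp)) := h2.symm
      _ ≤ a * (A₁ * (B * Lp)) := mul_le_mul_of_nonneg_left h1 hapos.le
  have hDLp : 0 ≤ D * Lp := by positivity
  have h2200Lp : 0 ≤ 2200 * Lp := by positivity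
  have hDLx : D * Lp ≤ expoB * Lx := by rw [← ha]; linarith
  have haLx : 2200 * Lp ≤ a * Lx := by linarith
  have haLx1500 : 1500 ≤ a * Lx := by linarith
  have hLxnn : 0 ≤ Lx := by rw [hLx]; positivity
  have hLx4 : 4 ≤ Lx := by nlinarith only [ha1, hLxnn, haLx1500, hapos]
  have hLx1 : 1 ≤ Lx := by linarith
  have hx1 : 1 ≤ x := by rw [hx]; exact Real.one_le_exp (by linarith)
  set T' : ℝ := P + 1 with hT'
  have hT'1 : 1 ≤ T' := by rw [hT']; linarith
  have hT'0 : 0 ≤ T' := by linarith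
  have hT'pos : 0 < T' := by linarith
  have hT'2 : T' ≤ 2 * P := by rw [hT']; linarith
  /- ── `NX = ⌊x^{a₀}⌋`, `z = ⌊NX^{1/(2n+4)}⌋` and the saving ── -/
  set NX : ℕ := ⌊x ^ a⌋₊ with hNX
  have hxa : x ^ a = Real.exp (a * Lx) := by rw [hx, ← Real.exp_mul, mul_comm]
  have hxa512 : (512 : ℝ) ≤ x ^ a := by
    rw [hxa]; linarith [Real.add_one_le_exp (a * Lx)]
  have hNXle : (NX : ℝ) ≤ x ^ a := Nat.floor_le (by positivity)
  have hNXgt : x ^ a < NX + 1 := Nat.lt_floor_add_one _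
  have hNXhalf : x ^ a / 2 ≤ NX := by linarith
  have hNX256 : (256 : ℝ) ≤ NX := by linarith
  have hNX1 : 1 ≤ NX := by exact_mod_cast (show (1 : ℝ) ≤ NX by linarith)
  have hNXpos : (0 : ℝ) < NX := by linarith
  set z : ℕ := ⌊(NX : ℝ) ^ (1 / (2 * (n : ℝ) + 4))⌋₊ with hz
  obtain ⟨hz1, hzNX, hzhalf, hM⟩ := hSV K hnK P T' Lx hP hd hh hκ hT'1 hT'2 hDLx NX z hNXle hNXhalf hz
  have hz1r : (1 : ℝ) ≤ z := by exact_mod_cast hz1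
  /- ── kernel parameters `A = (n+2)T'`, `m = n + 3` ── -/
  set nK : ℕ := Module.finrank ℚ K with hnK'
  set m : ℕ := nK + 3 with hm
  have hm3 : Module.finrank ℚ K + 3 ≤ m := le_rfl
  have hnKn : (nK : ℝ) ≤ n := by exact_mod_cast hnK
  have hmcast : (m : ℝ) = nK + 3 := by rw [hm]; push_cast; ring
  set A : ℝ := ((n : ℝ) + 2) * T' with hAdef
  have hA : 0 < A := by positivity
  have hTA : ((m : ℝ) + 1) * T' ^ 2 ≤ 3 * A ^ 2 := by
    rw [hmcast, hAdef]
    have hsq : 0 ≤ T' ^ 2 := sq_nonneg T'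
    have hcoef : (nK : ℝ) + 3 + 1 ≤ 3 * ((n : ℝ) + 2) ^ 2 := by
      have hsq' : (0 : ℝ) ≤ (n : ℝ) ^ 2 := sq_nonneg _
      nlinarith only [hnKn, hn0, hsq']
    calc ((nK : ℝ) + 3 + 1) * T' ^ 2 ≤ (3 * ((n : ℝ) + 2) ^ 2) * T' ^ 2 := mul_le_mul_of_nonneg_right hcoef hsq
      _ = 3 * (((n : ℝ) + 2) * T') ^ 2 := by ring
  /- ── the sieve side for every `t ∈ (NX, x]` ── -/
  set Bt : ℝ := 16 * π * C_M * Lx with hBt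
  have hsieve : ∀ t ∈ Set.Ioc (NX : ℝ) x,
      ∑ ψ : AddChar (Additive (ClassGroup (𝓞 K))) ℂ,
        ∫ v in (-T')..T', ‖summatory (coefSiftedB (coefB K (toMulHom ψ).toHomUnits v) x z) t‖ ^ 2 ≤ Bt := by
    intro t ht
    refine (sieveSide_classGroup x hz1 hzNX hT'pos hA hm3 hTA t).trans ?_
    have h2 : ∑ n ∈ (siftedSet x z).filter (fun n => n ≤ ⌊t⌋₊), Λ n * Real.log n / n ≤ 2 * Lx ^ 2 := by
      have hsub : (siftedSet x z).filter (fun n => n ≤ ⌊t⌋₊) ⊆ Icc 1 ⌊x⌋₊ := by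
        intro n hn
        rw [mem_filter] at hn
        obtain ⟨h1, h2, -⟩ := siftedSet_prop hn.1
        rw [mem_Icc]; omega
      refine (sum_le_sum_of_subset_of_nonneg hsub fun n _ _ => ?_).trans ?_
      · exact div_nonneg (mul_nonneg ArithmeticFunction.vonMangoldt_nonneg (Real.log_natCast_nonneg n)) (Nat.cast_nonneg n)
      refine (sum_vonMangoldt_mul_log_div_le ⌊x⌋₊).trans ?_
      have hfl : Real.log ⌊x⌋₊ ≤ Lx := by
        rw [← hlogx]
        rcases Nat.eq_zero_or_pos ⌊x⌋₊ with h0 | hpos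
        · rw [h0, Nat.cast_zero, Real.log_zero, hlogx]; linarith
        · exact Real.log_le_log (by exact_mod_cast hpos) (Nat.floor_le hxpos.le)
      have hfl0 : 0 ≤ Real.log ⌊x⌋₊ := Real.log_natCast_nonneg _
      have hl4 : Real.log 4 ≤ 1.4 := by
        have h : Real.log 4 = 2 * Real.log 2 := by
          rw [show (4:ℝ) = 2 ^ 2 by norm_num, Real.log_pow]; norm_num
        rw [h]; have := Real.log_two_lt_d9; linarith
      have h5 : Real.log ⌊x⌋₊ * (Real.log ⌊x⌋₊ + Real.log 4 + 2) ≤ Lx * (Lx + 4) :=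
        mul_le_mul hfl (by linarith) (by linarith [Real.log_nonneg (by norm_num : (1:ℝ) ≤ 4)]) hLxnn
      nlinarith only [h5, hLx4]
    have hnK1 : 1 / (Module.finrank ℚ K : ℝ) ≤ 1 := by
      rw [div_le_one (by exact_mod_cast Module.finrank_pos (R := ℚ) (M := K))]
      exact_mod_cast Module.finrank_pos (R := ℚ) (M := K)
    have hsum0 : 0 ≤ ∑ n ∈ (siftedSet x z).filter (fun n => n ≤ ⌊t⌋₊), Λ n * Real.log n / n :=
      sum_nonneg fun n _ => div_nonneg (mul_nonneg ArithmeticFunction.vonMangoldt_nonneg (Real.log_natCast_nonneg n)) (Nat.cast_nonneg n)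
    calc 8 * π * ((Fintype.card (ClassGroup (𝓞 K)) : ℝ) * meanValueConst K A m z ⌊x ^ expoB⌋₊ *
          (1 / (Module.finrank ℚ K : ℝ) * ∑ n ∈ (siftedSet x z).filter (fun n => n ≤ ⌊t⌋₊), Λ n * Real.log n / n))
        ≤ 8 * π * (C_M / Lx * (1 * (2 * Lx ^ 2))) := by
          rw [← ha, ← hNX]
          refine mul_le_mul_of_nonneg_left ?_ (by positivity)
          refine mul_le_mul hM (mul_le_mul hnK1 h2 hsum0 zero_le_one) (by positivity) (by positivity)
      _ = Bt := by rw [hBt]; field_simp; ring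
  /- ── the zero side for every `ψ ≠ 0` ── -/
  have hnKpos : (0 : ℝ) < Module.finrank ℚ K := by exact_mod_cast Module.finrank_pos (R := ℚ) (M := K)
  have hnpos : (0 : ℝ) < n := lt_of_lt_of_le hnKpos hnKn
  set L₀ : ℝ := Real.exp (-10) / (n : ℝ) ^ 2 * x ^ (-(r / 10)) / r ^ 3 with hL₀
  have hL₀pos : 0 < L₀ := by rw [hL₀]; positivity
  have hLL' : ∀ v : ℝ, |v| ≤ T' → lemmaAHeight K v ≤ L' := by
    intro v hv
    refine (lemmaAHeight_le_of_le hnK hP hd (by rw [hT'] at hv; exact hv)).trans ?_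
    rw [hL']; exact mul_le_mul_of_nonneg_right hB0 hLppos.le
  have hzero : ∀ ψ : AddChar (Additive (ClassGroup (𝓞 K))) ℂ, ψ ≠ 0 →
      r * L₀ * ∑ ρ ∈ Z (toMulHom ψ).toHomUnits with α ≤ ρ.re,
          (zeroOrder (classGroupLFunction₀ K (toMulHom ψ).toHomUnits) ρ : ℝ) ≤
        C_z * (r * L') * ∫ v in (-T')..T', meanValueCG (toMulHom ψ).toHomUnits x z v := by
    intro ψ hψ
    have hχ1 : (toMulHom ψ).toHomUnits ≠ 1 := toHomUnits_ne_one hψ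
    refine hZS K _ hχ1 hnK (hline _ hχ1) T' r L' x z _ hLL' hrpos hrr₀ hu hx1 hLxA₀ hzhalf hT'0 ?_
    intro ρ hρ
    rw [mem_filter] at hρ
    obtain ⟨h0, -, hre1, him⟩ := hZ _ hχ1 ρ hρ.1
    refine ⟨h0, by rw [hr]; linarith [hρ.2], hre1, ?_⟩
    rw [hT', hr]; linarith
  /- ── summing over `ψ` ── -/
  set S : ℝ := ∑ ψ : AddChar (Additive (ClassGroup (𝓞 K))) ℂ with ψ ≠ 0,
      ∑ ρ ∈ Z (toMulHom ψ).toHomUnits with α ≤ ρ.re,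
        (zeroOrder (classGroupLFunction₀ K (toMulHom ψ).toHomUnits) ρ : ℝ) with hS
  set f : AddChar (Additive (ClassGroup (𝓞 K))) ℂ → ℝ := fun ψ =>
      ∫ v in (-T')..T', meanValueCG (toMulHom ψ).toHomUnits x z v with hf
  have hf0 : ∀ ψ, 0 ≤ f ψ := fun ψ =>
      intervalIntegral.integral_nonneg (by linarith) fun v _ => meanValueCG_nonneg _ x z v
  have hstep1 : r * L₀ * S ≤ C_z * (r * L') * ∑ ψ : AddChar (Additive (ClassGroup (𝓞 K))) ℂ, f ψ := by
    rw [hS, mul_sum, mul_sum]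
    calc ∑ ψ ∈ univ.filter (fun ψ : AddChar (Additive (ClassGroup (𝓞 K))) ℂ => ψ ≠ 0),
          r * L₀ * ∑ ρ ∈ Z (toMulHom ψ).toHomUnits with α ≤ ρ.re,
            (zeroOrder (classGroupLFunction₀ K (toMulHom ψ).toHomUnits) ρ : ℝ)
        ≤ ∑ ψ ∈ univ.filter (fun ψ : AddChar (Additive (ClassGroup (𝓞 K))) ℂ => ψ ≠ 0), C_z * (r * L') * f ψ := by
          refine sum_le_sum fun ψ hψ => ?_
          rw [mem_filter] at hψ
          exact hzero ψ hψ.2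
      _ ≤ ∑ ψ : AddChar (Additive (ClassGroup (𝓞 K))) ℂ, C_z * (r * L') * f ψ :=
          sum_le_sum_of_subset_of_nonneg (filter_subset _ _) fun ψ _ _ => by
            exact mul_nonneg (by positivity) (hf0 ψ)
  -- Fubini and the sieve bound
  have hNXx : (NX : ℝ) ≤ x := by
    refine hNXle.trans ?_
    exact Real.rpow_le_self_of_one_le hx1 (by linarith)
  have hstep3 : ∑ ψ : AddChar (Additive (ClassGroup (𝓞 K))) ℂ, f ψ ≤ Bt * Lx := by
    set g : AddChar (Additive (ClassGroup (𝓞 K))) ℂ → ℝ → ℝ := fun ψ t =>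
      (∫ v in (-T')..T', ‖summatory (coefSiftedB (coefB K (toMulHom ψ).toHomUnits v) x z) t‖ ^ 2) / t with hg
    have hgi : ∀ ψ, IntegrableOn (g ψ) (Set.Ioc (NX : ℝ) x) :=
      fun ψ => integrableOn_inner_CG _ x z hNX1 hT'0
    have heq : ∀ ψ, f ψ = ∫ t in Set.Ioc (NX : ℝ) x, g ψ t := by
      intro ψ
      rw [hf, hg]
      exact integral_meanValueCG_eq _ x z hNX1 hT'0
    rw [sum_congr rfl fun ψ _ => heq ψ, ← integral_finsetSum _ fun ψ _ => hgi ψ]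
    have hBtint : IntegrableOn (fun t : ℝ => Bt * t⁻¹) (Set.Ioc (NX : ℝ) x) := by
      refine ((continuousOn_const.mul (continuousOn_inv₀.mono ?_)).integrableOn_compact isCompact_Icc).mono_set
        Set.Ioc_subset_Icc_self
      intro t ht; exact (hNXpos.trans_le ht.1).ne'
    calc ∫ t in Set.Ioc (NX : ℝ) x, ∑ ψ : AddChar (Additive (ClassGroup (𝓞 K))) ℂ, g ψ t
        ≤ ∫ t in Set.Ioc (NX : ℝ) x, Bt * t⁻¹ := by
          refine setIntegral_mono_on (integrable_finsetSum _ fun ψ _ => hgi ψ)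
            hBtint measurableSet_Ioc fun t ht => ?_
          have ht0 : 0 < t := hNXpos.trans ht.1
          have h1 := hsieve t ht
          have h2 : ∑ ψ : AddChar (Additive (ClassGroup (𝓞 K))) ℂ, g ψ t =
              (∑ ψ : AddChar (Additive (ClassGroup (𝓞 K))) ℂ,
                ∫ v in (-T')..T', ‖summatory (coefSiftedB (coefB K (toMulHom ψ).toHomUnits v) x z) t‖ ^ 2) / t := by
            rw [sum_div]
          rw [h2, div_eq_mul_inv]
          exact mul_le_mul_of_nonneg_right h1 (inv_nonneg.2 ht0.le)
      _ = Bt * Real.log (x / NX) := by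
          rw [integral_const_mul, ← intervalIntegral.integral_of_le hNXx, integral_inv_of_pos hNXpos hxpos]
      _ ≤ Bt * Lx := by
          refine mul_le_mul_of_nonneg_left ?_ (by positivity)
          rw [Real.log_div hxpos.ne' hNXpos.ne', hlogx]
          linarith [Real.log_nonneg (show (1:ℝ) ≤ NX by exact_mod_cast hNX1)]
  have hmain := hstep1.trans (mul_le_mul_of_nonneg_left hstep3 (by positivity))
  /- ── the final arithmetic ── -/
  -- `C_z (rL') (Bt Lx) = r (256π C_z C_M A₁² B³) Lp³ / 16 · 16`: we bound `L₀ ≥ e^{-10} x^{-r/10}/(16 r³)`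
  have hK : C_z * (r * L') * (Bt * Lx) = r * (K₁ * Lp ^ 3) / 16 := by
    rw [hBt, hLx, hL', hK₁]; field_simp; ring
  rw [hK] at hmain
  -- divide by `r L₀`, `L₀ = L₁/n²`
  set L₁ : ℝ := Real.exp (-10) * x ^ (-(r / 10)) / r ^ 3 with hL₁
  have hL₁pos : 0 < L₁ := by positivity
  have hL₀eq : L₀ = L₁ / (n : ℝ) ^ 2 := by rw [hL₀, hL₁]; field_simp
  have hS0 : 0 ≤ S := by
    rw [hS]; exact sum_nonneg fun ψ _ => sum_nonneg fun ρ _ => Nat.cast_nonneg _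
  have hdiv : S ≤ (n : ℝ) ^ 2 * (K₁ * Lp ^ 3) / L₁ := by
    have h1 : r * (L₁ / (n : ℝ) ^ 2 * S) ≤ r * (K₁ * Lp ^ 3) := by
      have h16 : r * (K₁ * Lp ^ 3) / 16 ≤ r * (K₁ * Lp ^ 3) := by
        have : 0 ≤ r * (K₁ * Lp ^ 3) := by positivity
        linarith
      calc r * (L₁ / (n : ℝ) ^ 2 * S) = r * L₀ * S := by rw [hL₀eq]; ring
        _ ≤ r * (K₁ * Lp ^ 3) / 16 := hmain
        _ ≤ r * (K₁ * Lp ^ 3) := h16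
    have h2 := le_of_mul_le_mul_left h1 hrpos
    rw [le_div_iff₀ hL₁pos]
    have h3 : L₁ / (n : ℝ) ^ 2 * S * (n : ℝ) ^ 2 = S * L₁ := by field_simp
    have h4 := mul_le_mul_of_nonneg_right h2 (show (0 : ℝ) ≤ (n : ℝ) ^ 2 by positivity)
    rw [h3] at h4
    linarith
  refine hdiv.trans ?_
  have hxr : x ^ (r / 10) = Real.exp (A₁ * B / 10 * r * Lp) := by
    rw [hx, ← Real.exp_mul, hLx, hL']; ring_nf
  have hL₁eq : K₁ * Lp ^ 3 / L₁ = K₁ * Real.exp 10 * ((r * Lp) ^ 3 * x ^ (r / 10)) := by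
    rw [hL₁, Real.rpow_neg hxpos.le, Real.exp_neg]
    have hx10 : 0 < x ^ (r / 10) := by positivity
    field_simp
  rw [mul_div_assoc, hL₁eq]
  have hcube : (r * Lp) ^ 3 ≤ Real.exp (3 * (r * Lp)) := cube_le_exp (by positivity)
  have hPpow : P ^ ((A₁ * B / 10 + 3) * 2 * (1 - α)) =
      Real.exp (3 * (r * Lp)) * Real.exp (A₁ * B / 10 * r * Lp) := by
    rw [Real.rpow_def_of_pos hPpos, ← Real.exp_add, ← hLp, hr]; ring_nf
  rw [hPpow, hxr]
  have hn1 : (n : ℝ) ^ 2 ≤ ((n : ℝ) + 1) ^ 2 := pow_le_pow_left₀ hn0 (by linarith) 2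
  have hrest : K₁ * Real.exp 10 * ((r * Lp) ^ 3 * Real.exp (A₁ * B / 10 * r * Lp)) ≤
      K₁ * Real.exp 10 * (Real.exp (3 * (r * Lp)) * Real.exp (A₁ * B / 10 * r * Lp)) :=
    mul_le_mul_of_nonneg_left (mul_le_mul_of_nonneg_right hcube (Real.exp_pos _).le) (by positivity)
  calc (n : ℝ) ^ 2 * (K₁ * Real.exp 10 * ((r * Lp) ^ 3 * Real.exp (A₁ * B / 10 * r * Lp)))
      ≤ ((n : ℝ) + 1) ^ 2 * (K₁ * Real.exp 10 * (Real.exp (3 * (r * Lp)) * Real.exp (A₁ * B / 10 * r * Lp))) :=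
        mul_le_mul hn1 hrest (by positivity) (by positivity)
    _ = ((n : ℝ) + 1) ^ 2 * (K₁ * Real.exp 10) * (Real.exp (3 * (r * Lp)) * Real.exp (A₁ * B / 10 * r * Lp)) := by
        ring

end Literature.NumberTheory.LFunctions.NumberField

end
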